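import Summits.QuantumFields.YangMills.Theorems.BalabanUVNodesN07ChartD56Series
import HarnessLib

/-!
# BalabanUVNodes ∕ N07 — [15] (56)'s SECOND RECURSIVE EQUATION, THE PRINTED THIRD-ORDER TERM «D^{(3)}(A′) = C_j^{(3)}(LʲηA′) − 2C_j^{(2)}(LʲηA′, LʲηHC^{(2)}(A′))», AT NODE 00's
# RECORD — for the TRUE multi-level chart `D(·)` of (47)–(49)

Cell `pub-ymgap`, width seat `pub-ymgap-dag-n07-w2` generation 6 (HUMAN RULING D-0149; DAG node N07 = [15] = [Balaban1985Variational]; W-SEAT START LIST §n07 item 2 = S2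
«[15] Sect. C (47)–(49), Prop. 3 at objects» — the sentence after (56), order three).  `--kind proof --supports stmt-QuantumFields-27364 --as helper` (K1⁹ face per KEY MAP v2;
count-neutral).  CONSUMED BY NAME, nothing modified: this seat's `N07ChartD56Series.exists_chartD56_series_T4` (ONE `(H, Dfun)` at the record with everything of generations 3–6,
incl. (56) as a convergent series with `D^{(n)}(A′) = (n!)⁻¹DⁿDfun(0)(A′)ⁿ`) and `N07ChartD56Series.iteratedDeriv_slice_eq_iteratedFDeriv`, `N07ChartLogAnalytic.analyticOnNhd_chartLog_
weightedBall_of_adm22`, dag k0-s1-w2's `K0Stub1ChartDAnalytic.isOpen_weightedBall`; Mathlib's `HasFDerivAt.comp_hasDerivAt`, `HasDerivAt.clm_apply`, `HasDerivAt.unique`,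
`ContDiffAt.isSymmSndFDerivAt`, `iteratedFDeriv_succ_apply_right`, `iteratedFDeriv_two_apply`.  The MODELS, cited BY NAME and not imported: lit-balaban r08's `B11Eq56Expansion.{D3_def,
eq56_order3(_fixedPoint)}` (the same identity in REMAINDER form over abstract bilinear∕trilinear hooks) and p06's `B11Eq56Order3Concrete` ∕ `B11Eq56ThirdTermConcrete` (the concrete
one-scale `ℤᵈ` fixed point).

THE PRINT (p. 286 [PDF 10], text layer `paper:balaban1985-cmp102-variational-background` p. 10 re-read by this seat): «From Eq. (56) a sequence of recursive equations for D^{(n)}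
follows. It can be solved easily. For example we have on Λ_j D^{(2)}(A′) = C_j^{(2)}(LʲηA′), D^{(3)}(A′) = C_j^{(3)}(LʲηA′) − 2C_j^{(2)}(LʲηA′, LʲηHC^{(2)}(A′)), and so on. Here
C_j^{(2)}(A′, A″) denotes a symmetric bilinear form obtained by polarization from the quadratic form C_j^{(2)}(A), and C^{(2)}(A′) = C_j^{(2)}(LʲηA′) on Λ_j.»

THE READING (tree vocabulary, scales absorbed; NO new definition).  With `C = chartLog η D`, `Q₂ = D²C(0)`, `Q₃ = D³C(0)`, `C^{(2)}(u, v) := ½Q₂(u)(v)` (the polarization of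
`C^{(2)}(u) = ½Q₂(u)(u)`), `C^{(3)}(A′) := (3!)⁻¹(d∕dτ)³C(τA′)|₀ = (3!)⁻¹Q₃(A′)(A′)(A′)` and `D^{(3)}(A′) := (3!)⁻¹(d∕dτ)³Dfun(τA′)|₀` (the order-three term of generation 6 FILE 2's
series), the printed equation is **`(d∕dτ)³Dfun(τA′)|₀ = Q₃(A′)³ − 3·Q₂(A′)(H·Q₂(A′)(A′))`** divided by `3!` (`2·½·½ = ½ = 3∕3!`).  Proof: the curve `γ(τ) = τA′ − H·Dfun(τA′)` has
`γ(0) = 0`, `γ′(0) = A′` (`𝔇(0) = 0`), `γ″(0) = −H·(d∕dτ)²Dfun(τA′)|₀ = −H·Q₂(A′)(A′)` ((56₁)); by (48) `C(γ(τ)) = τ·QA′` is LINEAR near `0`, so its second derivative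
`D²C(γ)(γ′, γ′) + DC(γ)(γ″)` vanishes near `0` and has zero derivative at `0`: `Q₃(A′)³ + 3Q₂(γ″(0), A′) + Q(γ‴(0)) = 0` with `Q∘H = 1` and the symmetry of `Q₂` — the order-three
step of the recursion, exactly as `N07ChartD2EqC2.fderiv_fderiv_eq_of_implicit` was the order-two step.

WHAT IS PROVED (sorry-free; no definition; axioms standard).  §1 (abstract, ℂ-normed `X`, complete `Y`) ★★★ `iteratedDeriv_three_slice_eq_of_implicit` (`Q∘H = 1`, (48) near `0`,
`Φ 0 = 0`, `DΦ(0) = 0`, `Φ`, `C` analytic at `0`, `DC(0) = Q` ⇒ `(d∕dτ)³Φ(τA)|₀ = D³C(0)(A,A,A) − 3·D²C(0)(A)(H·(d∕dτ)²Φ(τA)|₀)` for EVERY `A`) · `iteratedFDeriv_three_apply_const`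
(`D³f(x)(A,A,A)` as `iteratedFDeriv 3`); §2 ★★★★ `exists_chartD56_order3_T4` — `N07ChartD56Series.exists_chartD56_series_T4` RE-EXPORTED VERBATIM ∧ for the SAME `(H, Dfun)` and every `A′`:
`(d∕dτ)³chartLog(τA′)|₀ = Q₃(A′)³` · **`(d∕dτ)³Dfun(τA′)|₀ = Q₃(A′)³ − 3·Q₂(A′)(H(Q₂(A′)(A′)))`** · **PRINT's SHAPE `D^{(3)}(A′) = C^{(3)}(A′) − 2·C^{(2)}(A′, HC^{(2)}(A′))`**.
The nested continuous-linear-map spaces need the codomain passed explicitly to `HasFDerivAt.comp_hasDerivAt` (instance paths), noted in the proof.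

HONEST FRAMING: count-neutral helper; third-derivative chain rule ∕ uniqueness ∕ symmetry bookkeeping (Mathlib calculus) on this seat's record package — NO new estimate of [15];
«and so on» (orders ≥ 4), the polarizations beyond what is displayed, (58), the ∇-row of (46), (79)–(80), (85)–(86) and [15] Sects. D–F NOT here; stub 1 ∕ K0⁷ ∕ K1⁹ NOT
closed; N07 NOT discharged; counts unmoved; one finite T⁴ programme at fixed ε — NOT continuum ∕ ℝ⁴ ∕ OS ∕ mass gap ∕ Clay: the Yang–Mills mass gap is NOT proved by any of this; R4
closes the conditional rung `BalabanLadder.UV` only.  No `sorry`, no `def`, no `instance`, no `notation`.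

References: [15] T. Bałaban, CMP 102 (1985) 277–309 [Balaban1985Variational] ((47)–(49) p.285, (55)–(56) p.286, Prop. 3 p.289, (78)∕(80) p.290); [4] = [B7] CMP 98 (1985) 17–51
[Balaban1985Averaging] ((136) p.39).
-/

noncomputable section

open scoped BigOperators Matrix.Norms.L2Operator ContDiff Topology Nat
open NormedSpace Metric Set Filter Asymptotics

namespace Summit.QuantumFields.YangMills.BalabanUVNodes.N07ChartD56Order3

open Literature.MathematicalPhysics.QuantumFieldTheory.Balaban1983to89
open Literature.MathematicalPhysics.QuantumFieldTheory.Balaban1983to89.T4Continuum (T4Family)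
open B6SectADomainsV1 (Domains)
open B6SectAOperatorsV1 (BondIdx)
open Summit.QuantumFields.YangMills.Theorems.FlatCubeOpsText (Adm22 distBI)
open Summit.QuantumFields.YangMills.Theorems.K0FlatCubeOpsTextP (IsLevWeight levWeight_nonneg)
open Summit.QuantumFields.YangMills.Theorems.Prop8Chart (chartLog)
open Summit.QuantumFields.YangMills.Theorems.K0Stub1ChartDAnalytic (isOpen_weightedBall)
open Summit.QuantumFields.YangMills.BalabanUVNodes.N07ChartLogAnalytic (analyticOnNhd_chartLog_weightedBall_of_adm22)
open Summit.QuantumFields.YangMills.BalabanUVNodes.N07ChartD56Series (exists_chartD56_series_T4 iteratedDeriv_slice_eq_iteratedFDeriv)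

/-! ## §1 The third differentiation of (48) along a direction (abstract) -/

section Implicit

variable {X Y : Type*} [NormedAddCommGroup X] [NormedSpace ℂ X] [NormedAddCommGroup Y] [NormedSpace ℂ Y] [CompleteSpace Y]

/-- ★★★ **(56)'s SECOND RECURSIVE EQUATION, ABSTRACT FORM.**  Let `Q∘H = 1`, let (48) `C(B − HΦ(B)) = QB` hold near `0`, `Φ 0 = 0`, `DΦ(0) = 0`, `Φ` and `C` analytic at `0`,
`DC(0) = Q`.  Then for every direction `A`: **`(d∕dτ)³Φ(τA)|₀ = D³C(0)(A)(A)(A) − 3·D²C(0)(A)(H·(d∕dτ)²Φ(τA)|₀)`** — print's «D^{(3)}(A′) = C^{(3)} − 2C^{(2)}(A′, HC^{(2)}(A′))»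
times `3!`.  The curve `γ(τ) = τA − HΦ(τA)` (`γ(0) = 0`, `γ′(0) = A`, `γ″ = −H(Φ∘line)″`) makes `C∘γ` LINEAR near `0` ((48)); its derivative `DC(γ)γ′` is constant, so
`D²C(γ)(γ′)(γ′) + DC(γ)(γ″)` vanishes near `0`, and the derivative of the latter at `0` — `D³C(0)(A)³ + D²C(0)(γ″(0))(A) + 2D²C(0)(A)(γ″(0)) + Q(γ‴(0))` — is zero; `Q∘H = 1`, symmetry.
(Nested spaces of continuous linear maps: the codomain is passed explicitly to `HasFDerivAt.comp_hasDerivAt`.) [cite: Balaban1985Variational, (48) p.285, (56) p.286] -/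
theorem iteratedDeriv_three_slice_eq_of_implicit {Φ C : X → Y} {Q : X →L[ℂ] Y} {H : Y →L[ℂ] X}
    (hQH : ∀ y, Q (H y) = y)
    (h48 : ∀ᶠ B in 𝓝 (0 : X), C (B - H (Φ B)) = Q B)
    (hΦ0 : Φ 0 = 0) (hDΦ0 : fderiv ℂ Φ 0 = 0)
    (hΦa : AnalyticAt ℂ Φ 0) (hCa : AnalyticAt ℂ C 0) (hCQ : fderiv ℂ C 0 = Q) (A : X) :
    iteratedDeriv 3 (fun τ : ℂ => Φ (τ • A)) 0 =
      ((fderiv ℂ (fderiv ℂ (fderiv ℂ C)) 0 A) A) A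
        - (3 : ℕ) • (fderiv ℂ (fderiv ℂ C) 0 A) (H (iteratedDeriv 2 (fun τ : ℂ => Φ (τ • A)) 0)) := by
  -- analytic neighbourhoods of `0`
  have hΦev : ∀ᶠ x in 𝓝 (0 : X), AnalyticAt ℂ Φ x := hΦa.eventually_analyticAt
  have hCev : ∀ᶠ x in 𝓝 (0 : X), AnalyticAt ℂ C x := hCa.eventually_analyticAt
  set C₁ : X → (X →L[ℂ] Y) := fderiv ℂ C with hC₁
  set C₂ : X → (X →L[ℂ] X →L[ℂ] Y) := fderiv ℂ C₁ with hC₂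
  have hC₁a : AnalyticAt ℂ C₁ 0 := hCa.fderiv
  have hC₂a : AnalyticAt ℂ C₂ 0 := hC₁a.fderiv
  have hC₁ev : ∀ᶠ x in 𝓝 (0 : X), AnalyticAt ℂ C₁ x := hC₁a.eventually_analyticAt
  -- the line and the slice `g`
  have hlin : ∀ τ : ℂ, HasDerivAt (fun s : ℂ => s • A) A τ := fun τ => by
    simpa using (hasDerivAt_id τ).smul_const A
  have hcont : Continuous fun s : ℂ => s • A := continuous_id.smul continuous_const
  have hlin0 : Tendsto (fun s : ℂ => s • A) (𝓝 0) (𝓝 0) := by simpa using hcont.tendsto 0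
  set g : ℂ → Y := fun τ => Φ (τ • A) with hg
  have hgan : ∀ᶠ τ in 𝓝 (0 : ℂ), AnalyticAt ℂ g τ := by
    filter_upwards [hlin0.eventually hΦev] with τ hτ
    have hl : AnalyticAt ℂ (fun s : ℂ => s • A) τ := analyticAt_id.smul analyticAt_const
    exact AnalyticAt.comp (f := fun s : ℂ => s • A) hτ hl
  set g₁ : ℂ → Y := deriv g with hg₁
  set g₂ : ℂ → Y := deriv g₁ with hg₂
  have hg1 : ∀ᶠ τ in 𝓝 (0 : ℂ), HasDerivAt g (g₁ τ) τ := hgan.mono fun τ h => h.differentiableAt.hasDerivAt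
  have hg1an : ∀ᶠ τ in 𝓝 (0 : ℂ), AnalyticAt ℂ g₁ τ := hgan.mono fun τ h => h.deriv
  have hg2 : ∀ᶠ τ in 𝓝 (0 : ℂ), HasDerivAt g₁ (g₂ τ) τ := hg1an.mono fun τ h => h.differentiableAt.hasDerivAt
  have hg3 : HasDerivAt g₂ (deriv g₂ 0) 0 := (hg1an.self_of_nhds.deriv).differentiableAt.hasDerivAt
  have hg0 : g 0 = 0 := by simp [hg, hΦ0]
  have hg10 : g₁ 0 = 0 := by
    have h : HasDerivAt g ((fderiv ℂ Φ 0) A) 0 := by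
      have hd : HasFDerivAt Φ (fderiv ℂ Φ 0) ((0 : ℂ) • A) := by
        rw [zero_smul]; exact hΦa.differentiableAt.hasFDerivAt
      exact hd.comp_hasDerivAt (0 : ℂ) (hlin 0)
    rw [hg₁, h.deriv, hDΦ0]
    rfl
  -- the curve `γ = line − H g` and its derivatives
  set γ : ℂ → X := fun τ => τ • A - H (g τ) with hγ
  set γ₁ : ℂ → X := fun τ => A - H (g₁ τ) with hγ₁
  set γ₂ : ℂ → X := fun τ => -H (g₂ τ) with hγ₂
  have hγ1 : ∀ᶠ τ in 𝓝 (0 : ℂ), HasDerivAt γ (γ₁ τ) τ :=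
    hg1.mono fun τ h => (hlin τ).sub (H.hasFDerivAt.comp_hasDerivAt τ h)
  have hγ2 : ∀ᶠ τ in 𝓝 (0 : ℂ), HasDerivAt γ₁ (γ₂ τ) τ := hg2.mono fun τ h => by
    have h' := (hasDerivAt_const τ A).sub (H.hasFDerivAt.comp_hasDerivAt τ h)
    rw [zero_sub] at h'
    exact h'
  have hγ3 : HasDerivAt γ₂ (-H (deriv g₂ 0)) 0 := (H.hasFDerivAt.comp_hasDerivAt (0 : ℂ) hg3).neg
  have hγ0 : γ 0 = 0 := by simp [hγ, hg0]
  have hγ10 : γ₁ 0 = A := by simp [hγ₁, hg10]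
  have hγt : Tendsto γ (𝓝 0) (𝓝 0) := by
    have h := hγ1.self_of_nhds.continuousAt.tendsto
    rwa [hγ0] at h
  -- `C ∘ γ` is linear near `0` ((48) along the line)
  have hclin : ∀ᶠ τ in 𝓝 (0 : ℂ), C (γ τ) = τ • Q A := by
    filter_upwards [hlin0.eventually h48] with τ hτ
    simpa [hγ, hg] using hτ
  -- first derivative: `e₁ = C₁(γ) γ₁` equals `QA` near `0`
  set e₁ : ℂ → Y := fun τ => C₁ (γ τ) (γ₁ τ) with he₁
  have hCd : ∀ᶠ τ in 𝓝 (0 : ℂ), DifferentiableAt ℂ C (γ τ) := hγt.eventually (hCev.mono fun x hx => hx.differentiableAt)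
  have hc1 : ∀ᶠ τ in 𝓝 (0 : ℂ), HasDerivAt (fun s => C (γ s)) (e₁ τ) τ := by
    filter_upwards [hCd, hγ1] with τ hC hγ'
    exact hC.hasFDerivAt.comp_hasDerivAt τ hγ'
  have he1 : ∀ᶠ τ in 𝓝 (0 : ℂ), e₁ τ = Q A := by
    filter_upwards [hc1, hclin.eventually_nhds] with τ h1 hl
    have h2 : HasDerivAt (fun s : ℂ => C (γ s)) (Q A) τ := by
      have h3 : HasDerivAt (fun s : ℂ => s • Q A) (Q A) τ := by simpa using (hasDerivAt_id τ).smul_const (Q A)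
      exact h3.congr_of_eventuallyEq hl
    exact h1.unique h2
  -- second derivative: `e₂ = C₂(γ)(γ₁)(γ₁) + C₁(γ)(γ₂)` vanishes near `0`
  set e₂ : ℂ → Y := fun τ => (C₂ (γ τ) (γ₁ τ)) (γ₁ τ) + C₁ (γ τ) (γ₂ τ) with he₂
  have hC₁d : ∀ᶠ τ in 𝓝 (0 : ℂ), DifferentiableAt ℂ C₁ (γ τ) := hγt.eventually (hC₁ev.mono fun x hx => hx.differentiableAt)
  have hc2 : ∀ᶠ τ in 𝓝 (0 : ℂ), HasDerivAt e₁ (e₂ τ) τ := by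
    filter_upwards [hC₁d, hγ1, hγ2] with τ hC hγ' hγ''
    have hA : HasDerivAt (fun s => C₁ (γ s)) (C₂ (γ τ) (γ₁ τ)) τ := hC.hasFDerivAt.comp_hasDerivAt τ hγ'
    exact hA.clm_apply hγ''
  have he2 : ∀ᶠ τ in 𝓝 (0 : ℂ), e₂ τ = 0 := by
    filter_upwards [hc2, he1.eventually_nhds] with τ h2 hl
    exact h2.unique ((hasDerivAt_const τ (Q A)).congr_of_eventuallyEq hl)
  -- third derivative at `0` (terms built without expected types: CLM-valued chain rules)
  have hC₂d : DifferentiableAt ℂ C₂ (γ 0) := by rw [hγ0]; exact hC₂a.differentiableAt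
  have hA3 := HasFDerivAt.comp_hasDerivAt (E := X →L[ℂ] X →L[ℂ] Y) (0 : ℂ) hC₂d.hasFDerivAt hγ1.self_of_nhds
  have hB3 := hA3.clm_apply hγ2.self_of_nhds
  have hC3 := hB3.clm_apply hγ2.self_of_nhds
  have hD3 := HasFDerivAt.comp_hasDerivAt (0 : ℂ) hC₁d.self_of_nhds.hasFDerivAt hγ1.self_of_nhds
  have hE3 := hD3.clm_apply hγ3
  have hc3 := hC3.add hE3
  have h30 : HasDerivAt e₂ (0 : Y) 0 := (hasDerivAt_const (0 : ℂ) (0 : Y)).congr_of_eventuallyEq he2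
  have hzero := hc3.unique h30
  -- evaluate
  have hsym : ∀ u v : X, C₂ 0 u v = C₂ 0 v u := fun u v => ((hCa.contDiffAt (n := ω)).isSymmSndFDerivAt (by simp)) u v
  have hC₁0 : C₁ 0 = Q := hCQ
  simp only [Function.comp_apply, hγ0, hγ10, hγ₂, map_neg, neg_apply, add_apply, hC₁0, hQH] at hzero
  rw [hsym (H (g₂ 0)) A] at hzero
  -- `iteratedDeriv 3 g 0 = deriv g₂ 0`, `iteratedDeriv 2 g 0 = g₂ 0`
  have hi2 : iteratedDeriv 2 (fun τ : ℂ => Φ (τ • A)) 0 = g₂ 0 := by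
    rw [show (2 : ℕ) = 1 + 1 from rfl, iteratedDeriv_succ, iteratedDeriv_one]
  have hi3 : iteratedDeriv 3 (fun τ : ℂ => Φ (τ • A)) 0 = deriv g₂ 0 := by
    rw [show (3 : ℕ) = 2 + 1 from rfl, iteratedDeriv_succ, show (2 : ℕ) = 1 + 1 from rfl, iteratedDeriv_succ, iteratedDeriv_one]
  rw [hi2, hi3]
  rw [← hC₂] at hzero
  set Z : Y := ((C₂ 0) A) (H (g₂ 0)) with hZ
  set W : Y := (((fderiv ℂ C₂ 0) A) A) A with hW
  have h3 : (3 : ℕ) • Z = Z + Z + Z := by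
    rw [show (3 : ℕ) = 2 + 1 from rfl, succ_nsmul, two_nsmul]
  calc deriv g₂ 0 = deriv g₂ 0 + (W + -Z + -Z + (-Z + -deriv g₂ 0)) := by rw [hzero, add_zero]
    _ = W - (3 : ℕ) • Z := by rw [h3]; abel

omit [CompleteSpace Y] in
/-- `D³f(x)(A, A, A)` as the third iterated Fréchet derivative on the constant triple (`iteratedFDeriv_succ_apply_right` + `iteratedFDeriv_two_apply`). [folklore] -/
theorem iteratedFDeriv_three_apply_const (f : X → Y) (x A : X) :
    iteratedFDeriv ℂ 3 f x (fun _ => A) = ((fderiv ℂ (fderiv ℂ (fderiv ℂ f)) x A) A) A := by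
  rw [iteratedFDeriv_succ_apply_right, iteratedFDeriv_two_apply]
  rfl

end Implicit

/-! ## §2 (56) at order three at NODE 00's record -/

/-- ★★★★ **[15] (56), THE PRINTED THIRD-ORDER TERM «D^{(3)}(A′) = C_j^{(3)}(LʲηA′) − 2C_j^{(2)}(LʲηA′, LʲηHC^{(2)}(A′))», FOR THE TRUE MULTI-LEVEL CHART AT NODE 00's RECORD.**
`N07ChartD56Series.exists_chartD56_series_T4` RE-EXPORTED VERBATIM (thresholds, constants, binders, the SAME `(H, Dfun)` with everything of generations 3–6) — AND, with
`Q₂ := D²chartLog(0)`, `Q₃ := D³chartLog(0)`, for EVERY `A′`: **`(d∕dτ)³chartLog(τA′)|₀ = Q₃(A′)(A′)(A′)`**; **`(d∕dτ)³Dfun(τA′)|₀ = Q₃(A′)(A′)(A′) − 3·Q₂(A′)(H(Q₂(A′)(A′)))`**;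
and PRINT's SHAPE **`(3!)⁻¹(d∕dτ)³Dfun(τA′)|₀ = (3!)⁻¹(d∕dτ)³chartLog(τA′)|₀ − 2·[½Q₂(A′)](H[½Q₂(A′)(A′)])`** = «D^{(3)}(A′) = C^{(3)}(A′) − 2C^{(2)}(A′, HC^{(2)}(A′))» with `C^{(2)}(u, v) =
½Q₂(u)(v)` the polarization of `C^{(2)}(u) = ½Q₂(u)(u)` and `D^{(3)}`, `C^{(3)}` the order-three Taylor terms of the slices (`= (3!)⁻¹D³(·)(0)(A′)³`, FILE 2).  §1 on the record package
(`Dfun` analytic at `0` from `C^ω`, `chartLog` analytic at `0` on the weighted `R⋆`-ball, `H` continuous by finite dimension, `(d∕dτ)²Dfun(τA′)|₀ = Q₂(A′)(A′)` by (56₁)).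
[cite: Balaban1985Variational, (47)-(49) p.285, (55)-(56) p.286, Prop. 3 p.289] -/
theorem exists_chartD56_order3_T4 {ι : Type*} [Fintype ι] [DecidableEq ι] [Nonempty ι] (F : T4Family) :
    ∃ (Mh₀ R₀ : ℕ) (CK δ₀ B₃ : ℝ), 0 ≤ CK ∧ 0 < δ₀ ∧ 0 < B₃ ∧
    ∀ (n K : ℕ) (_ : 1 ≤ K - n) (_ : K - n + 1 ≤ F.m + K) {Mh R a' : ℕ} (_ : Mh = F.L ^ a') (_ : Mh₀ ≤ Mh) (_ : R₀ ≤ R) (_ : 2 * F.L ≤ R)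
      (_ : a' + 3 ≤ F.m + n) (D : Domains (F.P K)) (_ : D.k = K - n) (_ : Adm22 D R (F.L * Mh))
      (w : ℕ → PBond (F.P K) 0 → ℝ) (_ : IsLevWeight (F.P K) (K - n) D w) {ε : ℝ} (_ : 0 < ε)
      (_ : 18 * (960 * ((((F.P K).d + 2) * (F.P K).L : ℕ) : ℝ) * ((F.P K).L : ℝ) / (12800 * ((((F.P K).d + 2) * (F.P K).L : ℕ) : ℝ) ^ 2 * ((F.P K).L : ℝ))⁻¹) *
        (CK * B₃ * (1 + 2 * (((F.P K).d + 2) * (F.P K).L : ℕ)) * (1 + 2 * (((F.P K).d + 2) * (F.P K).L : ℕ) * (1 + (F.P K).L))) * ε ≤ 1)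
      (_ : 64 * ε ≤ (12800 * ((((F.P K).d + 2) * (F.P K).L : ℕ) : ℝ) ^ 2 * ((F.P K).L : ℝ))⁻¹),
      let η : ℝ := (((F.P K).L : ℝ)⁻¹) ^ (K - n)
      let Rs : ℝ := (12800 * ((((F.P K).d + 2) * (F.P K).L : ℕ) : ℝ) ^ 2 * ((F.P K).L : ℝ))⁻¹
      let C₂ : ℝ := 960 * ((((F.P K).d + 2) * (F.P K).L : ℕ) : ℝ) * ((F.P K).L : ℝ) / Rs
      let C₃ : ℝ := 3840 * ((((F.P K).d + 2) * (F.P K).L : ℕ) : ℝ) * ((F.P K).L : ℝ) / Rs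
      let Qlin := (fderiv ℂ (chartLog η D : (PBond (F.P K) 0 → Matrix ι ι ℂ) → BondIdx D → Matrix ι ι ℂ) 0)
      let Q₂ := (fderiv ℂ (fderiv ℂ (chartLog η D : (PBond (F.P K) 0 → Matrix ι ι ℂ) → BondIdx D → Matrix ι ι ℂ)) 0)
      let Q₃ := (fderiv ℂ (fderiv ℂ (fderiv ℂ (chartLog η D : (PBond (F.P K) 0 → Matrix ι ι ℂ) → BondIdx D → Matrix ι ι ℂ))) 0)
      ∃ (H : (BondIdx D → Matrix ι ι ℂ) →ₗ[ℂ] (PBond (F.P K) 0 → Matrix ι ι ℂ)) (Dfun : (PBond (F.P K) 0 → Matrix ι ι ℂ) → (BondIdx D → Matrix ι ι ℂ)),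
        (∀ X, Qlin (H X) = X) ∧
        (∀ (X : BondIdx D → Matrix ι ι ℂ) (t : ℝ), 0 ≤ t → (∀ i, ‖X i‖ ≤ t) → ∀ b,
          w 1 b * ‖H X b‖ ≤ CK * B₃ * (1 + 2 * (((F.P K).d + 2) * (F.P K).L : ℕ)) * (1 + 2 * (((F.P K).d + 2) * (F.P K).L : ℕ) * (1 + (F.P K).L)) * t) ∧
        ContDiffOn ℂ ω Dfun {A' : PBond (F.P K) 0 → Matrix ι ι ℂ | ∀ b, w 1 b * ‖A' b‖ < ε} ∧
        DifferentiableOn ℂ (fderiv ℂ Dfun) {A' : PBond (F.P K) 0 → Matrix ι ι ℂ | ∀ b, w 1 b * ‖A' b‖ < ε} ∧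
        fderiv ℂ Dfun 0 = 0 ∧
        (∀ A' : PBond (F.P K) 0 → Matrix ι ι ℂ, (∀ b, w 1 b * ‖A' b‖ < ε) →
          (∀ (ρ : ℝ), 0 ≤ ρ → (∀ b, w 1 b * ‖A' b‖ ≤ ρ) → ∀ i, ‖Dfun A' i‖ ≤ 4 * C₂ * ρ ^ 2) ∧
          chartLog η D (A' - H (Dfun A')) - Qlin (A' - H (Dfun A')) = Dfun A' ∧
          chartLog η D (A' - H (Dfun A')) = Qlin A' ∧
          HasFDerivAt Dfun (fderiv ℂ Dfun A') A' ∧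
          (∀ (W : PBond (F.P K) 0 → Matrix ι ι ℂ) (t : ℝ), 0 ≤ t → (∀ b, w 1 b * ‖W b‖ ≤ t) → ∀ i, ‖fderiv ℂ Dfun A' W i‖ ≤ 4 * C₃ * ε * t) ∧
          ∀ (b : PBond (F.P K) 0) (a : Matrix ι ι ℂ) (δ : ℝ), 0 ≤ δ → δ ≤ δ₀ / 2 →
            4 * C₃ * Real.exp (δ * 3) *
                (CK * B₃ * (1 + 2 * (((F.P K).d + 2) * (F.P K).L : ℕ) * Real.exp (δ * 4)) *
                  (1 + 2 * (((F.P K).d + 2) * (F.P K).L : ℕ) * (1 + (F.P K).L) * Real.exp (δ * 1))) * ε ≤ 1 →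
            ∀ i, ‖fderiv ℂ Dfun A' (Pi.single b a) i‖ ≤ 4 * C₃ * ε * Real.exp (δ * 2) * (w 1 b * ‖a‖) * Real.exp (-(δ * distBI D b i))) ∧
        (∀ σ : ℝ, 0 < σ → ∀ A' : PBond (F.P K) 0 → Matrix ι ι ℂ, (∀ b, w 1 b * ‖A' b‖ ≤ σ) →
          ∀ (W : PBond (F.P K) 0 → Matrix ι ι ℂ) (t : ℝ), 0 ≤ t → (∀ b, w 1 b * ‖W b‖ ≤ t) → ∀ i,
            ‖(fderiv ℂ (fderiv ℂ Dfun) 0 A') W i‖ ≤ 4 * C₃ * σ * t) ∧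
        (∀ σ : ℝ, 0 < σ → ∀ A' : PBond (F.P K) 0 → Matrix ι ι ℂ, (∀ b, w 1 b * ‖A' b‖ ≤ σ) →
          ∀ (b : PBond (F.P K) 0) (a : Matrix ι ι ℂ) (δ : ℝ), 0 ≤ δ → δ ≤ δ₀ / 2 →
            4 * C₃ * Real.exp (δ * 3) *
                (CK * B₃ * (1 + 2 * (((F.P K).d + 2) * (F.P K).L : ℕ) * Real.exp (δ * 4)) *
                  (1 + 2 * (((F.P K).d + 2) * (F.P K).L : ℕ) * (1 + (F.P K).L) * Real.exp (δ * 1))) * ε ≤ 1 →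
            ∀ i, ‖(fderiv ℂ (fderiv ℂ Dfun) 0 A') (Pi.single b a) i‖ ≤
              4 * C₃ * σ * Real.exp (δ * 2) * (w 1 b * ‖a‖) * Real.exp (-(δ * distBI D b i))) ∧
        (∀ σ : ℝ, 0 < σ → σ < ε → ∀ A' : PBond (F.P K) 0 → Matrix ι ι ℂ, (∀ b, w 1 b * ‖A' b‖ ≤ σ) →
          ∀ (W : PBond (F.P K) 0 → Matrix ι ι ℂ) (t : ℝ), 0 ≤ t → (∀ b, w 1 b * ‖W b‖ ≤ t) → ∀ i,
            ‖(fderiv ℂ Dfun A' - fderiv ℂ (fderiv ℂ Dfun) 0 A') W i‖ ≤ 8 * C₃ * (σ ^ 2 / ε) * t) ∧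
        (∀ σ : ℝ, 0 < σ → σ < ε → ∀ A' : PBond (F.P K) 0 → Matrix ι ι ℂ, (∀ b, w 1 b * ‖A' b‖ ≤ σ) →
          ∀ (b : PBond (F.P K) 0) (a : Matrix ι ι ℂ) (δ : ℝ), 0 ≤ δ → δ ≤ δ₀ / 2 →
            4 * C₃ * Real.exp (δ * 3) *
                (CK * B₃ * (1 + 2 * (((F.P K).d + 2) * (F.P K).L : ℕ) * Real.exp (δ * 4)) *
                  (1 + 2 * (((F.P K).d + 2) * (F.P K).L : ℕ) * (1 + (F.P K).L) * Real.exp (δ * 1))) * ε ≤ 1 →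
            ∀ i, ‖(fderiv ℂ Dfun A' - fderiv ℂ (fderiv ℂ Dfun) 0 A') (Pi.single b a) i‖ ≤
              8 * C₃ * Real.exp (δ * 2) * (σ ^ 2 / ε) * (w 1 b * ‖a‖) * Real.exp (-(δ * distBI D b i))) ∧
        (∀ σ : ℝ, 0 < σ → ∀ A' : PBond (F.P K) 0 → Matrix ι ι ℂ, (∀ b, w 1 b * ‖A' b‖ ≤ σ) → ∀ i,
            ‖(2 : ℂ)⁻¹ • ((fderiv ℂ (fderiv ℂ Dfun) 0 A') A') i‖ ≤ 4 * C₂ * σ ^ 2) ∧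
        (∀ σ : ℝ, 0 < σ → σ < ε → ∀ A' : PBond (F.P K) 0 → Matrix ι ι ℂ, (∀ b, w 1 b * ‖A' b‖ ≤ σ) → ∀ i,
            ‖Dfun A' i - (2 : ℂ)⁻¹ • ((fderiv ℂ (fderiv ℂ Dfun) 0 A') A') i‖ ≤ 8 * C₂ * (σ ^ 3 / ε)) ∧
        fderiv ℂ (fderiv ℂ Dfun) 0 = Q₂ ∧
        (∀ A B : PBond (F.P K) 0 → Matrix ι ι ℂ, (fderiv ℂ (fderiv ℂ Dfun) 0 A) B = (fderiv ℂ (fderiv ℂ Dfun) 0 B) A) ∧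
        (∀ A B : PBond (F.P K) 0 → Matrix ι ι ℂ, (Q₂ A) B = (Q₂ B) A) ∧
        (∀ A' : PBond (F.P K) 0 → Matrix ι ι ℂ, (2 : ℂ)⁻¹ • (fderiv ℂ (fderiv ℂ Dfun) 0 A') A' = (2 : ℂ)⁻¹ • (Q₂ A') A') ∧
        (∀ A' : PBond (F.P K) 0 → Matrix ι ι ℂ,
          HasFDerivAt (fun A : PBond (F.P K) 0 → Matrix ι ι ℂ => (2 : ℂ)⁻¹ • (fderiv ℂ (fderiv ℂ Dfun) 0 A) A) (fderiv ℂ (fderiv ℂ Dfun) 0 A') A') ∧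
        (∀ A' : PBond (F.P K) 0 → Matrix ι ι ℂ,
          HasFDerivAt (fun A : PBond (F.P K) 0 → Matrix ι ι ℂ => (2 : ℂ)⁻¹ • (Q₂ A) A) (fderiv ℂ (fderiv ℂ Dfun) 0 A') A') ∧
        (∀ A' : PBond (F.P K) 0 → Matrix ι ι ℂ, (∀ b, w 1 b * ‖A' b‖ < ε) →
          HasFDerivAt (fun A : PBond (F.P K) 0 → Matrix ι ι ℂ => Dfun A - (2 : ℂ)⁻¹ • (Q₂ A) A) (fderiv ℂ Dfun A' - Q₂ A') A') ∧
        (∀ σ : ℝ, 0 < σ → ∀ A' : PBond (F.P K) 0 → Matrix ι ι ℂ, (∀ b, w 1 b * ‖A' b‖ ≤ σ) → ∀ i,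
            ‖(2 : ℂ)⁻¹ • ((Q₂ A') A') i‖ ≤ 4 * C₂ * σ ^ 2) ∧
        (∀ σ : ℝ, 0 < σ → σ < ε → ∀ A' : PBond (F.P K) 0 → Matrix ι ι ℂ, (∀ b, w 1 b * ‖A' b‖ ≤ σ) → ∀ i,
            ‖Dfun A' i - (2 : ℂ)⁻¹ • ((Q₂ A') A') i‖ ≤ 8 * C₂ * (σ ^ 3 / ε)) ∧
        (∀ σ : ℝ, 0 < σ → ∀ A' : PBond (F.P K) 0 → Matrix ι ι ℂ, (∀ b, w 1 b * ‖A' b‖ ≤ σ) →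
          ∀ (W : PBond (F.P K) 0 → Matrix ι ι ℂ) (t : ℝ), 0 ≤ t → (∀ b, w 1 b * ‖W b‖ ≤ t) → ∀ i,
            ‖(Q₂ A') W i‖ ≤ 4 * C₃ * σ * t) ∧
        (∀ σ : ℝ, 0 < σ → ∀ A' : PBond (F.P K) 0 → Matrix ι ι ℂ, (∀ b, w 1 b * ‖A' b‖ ≤ σ) →
          ∀ (b : PBond (F.P K) 0) (a : Matrix ι ι ℂ) (δ : ℝ), 0 ≤ δ → δ ≤ δ₀ / 2 →
            4 * C₃ * Real.exp (δ * 3) *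
                (CK * B₃ * (1 + 2 * (((F.P K).d + 2) * (F.P K).L : ℕ) * Real.exp (δ * 4)) *
                  (1 + 2 * (((F.P K).d + 2) * (F.P K).L : ℕ) * (1 + (F.P K).L) * Real.exp (δ * 1))) * ε ≤ 1 →
            ∀ i, ‖(Q₂ A') (Pi.single b a) i‖ ≤
              4 * C₃ * σ * Real.exp (δ * 2) * (w 1 b * ‖a‖) * Real.exp (-(δ * distBI D b i))) ∧
        (∀ σ : ℝ, 0 < σ → σ < ε → ∀ A' : PBond (F.P K) 0 → Matrix ι ι ℂ, (∀ b, w 1 b * ‖A' b‖ ≤ σ) →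
          ∀ (W : PBond (F.P K) 0 → Matrix ι ι ℂ) (t : ℝ), 0 ≤ t → (∀ b, w 1 b * ‖W b‖ ≤ t) → ∀ i,
            ‖(fderiv ℂ Dfun A' - Q₂ A') W i‖ ≤ 8 * C₃ * (σ ^ 2 / ε) * t) ∧
        (∀ σ : ℝ, 0 < σ → σ < ε → ∀ A' : PBond (F.P K) 0 → Matrix ι ι ℂ, (∀ b, w 1 b * ‖A' b‖ ≤ σ) →
          ∀ (b : PBond (F.P K) 0) (a : Matrix ι ι ℂ) (δ : ℝ), 0 ≤ δ → δ ≤ δ₀ / 2 →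
            4 * C₃ * Real.exp (δ * 3) *
                (CK * B₃ * (1 + 2 * (((F.P K).d + 2) * (F.P K).L : ℕ) * Real.exp (δ * 4)) *
                  (1 + 2 * (((F.P K).d + 2) * (F.P K).L : ℕ) * (1 + (F.P K).L) * Real.exp (δ * 1))) * ε ≤ 1 →
            ∀ i, ‖(fderiv ℂ Dfun A' - Q₂ A') (Pi.single b a) i‖ ≤
              8 * C₃ * Real.exp (δ * 2) * (σ ^ 2 / ε) * (w 1 b * ‖a‖) * Real.exp (-(δ * distBI D b i))) ∧
        (∀ σ : ℝ, 0 < σ → σ < ε → ∀ A' : PBond (F.P K) 0 → Matrix ι ι ℂ, (∀ b, w 1 b * ‖A' b‖ ≤ σ) →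
          HasSum (fun n : ℕ => (n ! : ℂ)⁻¹ • iteratedDeriv n (fun τ : ℂ => Dfun (τ • A')) 0) (Dfun A')) ∧
        (∀ (A' : PBond (F.P K) 0 → Matrix ι ι ℂ) (n : ℕ),
          iteratedDeriv n (fun τ : ℂ => Dfun (τ • A')) 0 = iteratedFDeriv ℂ n Dfun 0 (fun _ => A')) ∧
        (∀ A' : PBond (F.P K) 0 → Matrix ι ι ℂ, iteratedDeriv 0 (fun τ : ℂ => Dfun (τ • A')) 0 = 0) ∧
        (∀ A' : PBond (F.P K) 0 → Matrix ι ι ℂ, iteratedDeriv 1 (fun τ : ℂ => Dfun (τ • A')) 0 = 0) ∧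
        (∀ A' : PBond (F.P K) 0 → Matrix ι ι ℂ,
          ((2 : ℕ) ! : ℂ)⁻¹ • iteratedDeriv 2 (fun τ : ℂ => Dfun (τ • A')) 0 = (2 : ℂ)⁻¹ • (Q₂ A') A') ∧
        (∀ (A' : PBond (F.P K) 0 → Matrix ι ι ℂ) (s : ℂ) (n : ℕ),
          iteratedDeriv n (fun τ : ℂ => Dfun (τ • (s • A'))) 0 = s ^ n • iteratedDeriv n (fun τ : ℂ => Dfun (τ • A')) 0) ∧
        (∀ σ : ℝ, 0 < σ → ∀ A' : PBond (F.P K) 0 → Matrix ι ι ℂ, (∀ b, w 1 b * ‖A' b‖ ≤ σ) → ∀ (n : ℕ) (i : BondIdx D),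
          ‖((n ! : ℂ)⁻¹ • iteratedDeriv n (fun τ : ℂ => Dfun (τ • A')) 0) i‖ ≤ 4 * C₂ * ε ^ 2 * (σ / ε) ^ n) ∧
        (∀ σ : ℝ, 0 < σ → σ < ε → ∀ A' : PBond (F.P K) 0 → Matrix ι ι ℂ, (∀ b, w 1 b * ‖A' b‖ ≤ σ) → ∀ (N : ℕ) (i : BondIdx D),
          ‖Dfun A' i - (∑ n ∈ Finset.range N, (n ! : ℂ)⁻¹ • iteratedDeriv n (fun τ : ℂ => Dfun (τ • A')) 0) i‖ ≤
            4 * C₂ * ε ^ 2 * (σ / ε) ^ N * (1 - σ / ε)⁻¹) ∧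
        (∀ A' : PBond (F.P K) 0 → Matrix ι ι ℂ,
          iteratedDeriv 3 (fun τ : ℂ => (chartLog η D : (PBond (F.P K) 0 → Matrix ι ι ℂ) → BondIdx D → Matrix ι ι ℂ) (τ • A')) 0 = ((Q₃ A') A') A') ∧
        (∀ A' : PBond (F.P K) 0 → Matrix ι ι ℂ,
          iteratedDeriv 3 (fun τ : ℂ => Dfun (τ • A')) 0 = ((Q₃ A') A') A' - (3 : ℕ) • (Q₂ A') (H ((Q₂ A') A'))) ∧
        (∀ A' : PBond (F.P K) 0 → Matrix ι ι ℂ,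
          ((3 : ℕ) ! : ℂ)⁻¹ • iteratedDeriv 3 (fun τ : ℂ => Dfun (τ • A')) 0 =
            ((3 : ℕ) ! : ℂ)⁻¹ • iteratedDeriv 3 (fun τ : ℂ => (chartLog η D : (PBond (F.P K) 0 → Matrix ι ι ℂ) → BondIdx D → Matrix ι ι ℂ) (τ • A')) 0
              - (2 : ℕ) • ((2 : ℂ)⁻¹ • (Q₂ A') (H ((2 : ℂ)⁻¹ • (Q₂ A') A')))) := by
  classical
  obtain ⟨Mh₀, R₀, CK, δ₀, B₃, hCK, hδ₀, hB₃, hmain⟩ := exists_chartD56_series_T4 (ι := ι) F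
  refine ⟨Mh₀, R₀, CK, δ₀, B₃, hCK, hδ₀, hB₃, ?_⟩
  intro n K hk1 hk' Mh R a' hMha hMh hR h2L hsize D hDk hAdm w hw ε hε h18 h2 η Rs C₂ C₃ Qlin Q₂ Q₃
  obtain ⟨H, Dfun, hHinv, hsup, hω, hfd, h0, hpt, hlinN, hlinK, h2N, h2K, hD2', hD3, h56, hsymD, hsymC, h56₂, hderD, hderC, hderD3,
    hC2N, hC3N, hQlinN, hQlinK, hQ2N, hQ2K, hsum, hdiag, hord0, hord1, hord2, hhom, hcau, htail⟩ :=
    hmain n K hk1 hk' hMha hMh hR h2L hsize D hDk hAdm w hw hε h18 h2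
  -- the open weighted ball, `0` in it; `Dfun 0 = 0`; `Dfun` analytic at `0`
  have hU : IsOpen {A' : PBond (F.P K) 0 → Matrix ι ι ℂ | ∀ b, w 1 b * ‖A' b‖ < ε} := isOpen_weightedBall w ε
  have h0U : (0 : PBond (F.P K) 0 → Matrix ι ι ℂ) ∈ {A' : PBond (F.P K) 0 → Matrix ι ι ℂ | ∀ b, w 1 b * ‖A' b‖ < ε} := fun b => by simpa using hε
  have hUn : {A' : PBond (F.P K) 0 → Matrix ι ι ℂ | ∀ b, w 1 b * ‖A' b‖ < ε} ∈ 𝓝 (0 : PBond (F.P K) 0 → Matrix ι ι ℂ) := hU.mem_nhds h0U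
  have hΦ0 : Dfun 0 = 0 := by
    funext i
    have h := (hpt 0 h0U).1 0 le_rfl (fun b => by simp) i
    rw [zero_pow two_ne_zero, mul_zero] at h
    exact norm_le_zero_iff.mp h
  have hΦa : AnalyticAt ℂ Dfun 0 := (hω.contDiffAt hUn).analyticAt
  -- the charted constraint is analytic at `0` (weighted `R⋆`-ball, collar from (2.2)-admissibility)
  have hL1 : 1 ≤ F.L := by have := F.hL11; omega
  have hM : 1 ≤ F.L * Mh := by
    rw [hMha]; exact Nat.one_le_iff_ne_zero.mpr (Nat.mul_ne_zero (by omega) (pow_ne_zero _ (by omega)))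
  have hPL : (F.P K).L = F.L := rfl
  have hRM : 2 * (F.P K).L ≤ R * (F.L * Mh) + 1 := by
    have : R ≤ R * (F.L * Mh) := Nat.le_mul_of_pos_right R hM
    rw [hPL]; omega
  have hden : 0 < 12800 * ((((F.P K).d + 2) * (F.P K).L : ℕ) : ℝ) ^ 2 * ((F.P K).L : ℝ) := by
    have hL0 : (0 : ℝ) < (F.P K).L := by exact_mod_cast (F.P K).L_pos
    have hℓ1 : (1 : ℝ) ≤ ((((F.P K).d + 2) * (F.P K).L : ℕ) : ℝ) := by
      exact_mod_cast Nat.one_le_iff_ne_zero.mpr (Nat.mul_ne_zero (by omega) (by have := (F.P K).hL.2; omega))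
    positivity
  have hRs0 : 0 < Rs := inv_pos.mpr hden
  have hRs1 : 12800 * ((((F.P K).d + 2) * (F.P K).L : ℕ) : ℝ) ^ 2 * ((F.P K).L : ℝ) * Rs ≤ 1 := by
    show 12800 * ((((F.P K).d + 2) * (F.P K).L : ℕ) : ℝ) ^ 2 * ((F.P K).L : ℝ) *
        (12800 * ((((F.P K).d + 2) * (F.P K).L : ℕ) : ℝ) ^ 2 * ((F.P K).L : ℝ))⁻¹ ≤ 1
    rw [mul_inv_cancel₀ hden.ne']
  have han := analyticOnNhd_chartLog_weightedBall_of_adm22 (𝔸 := Matrix ι ι ℂ) (K - n) D hDk hAdm hRM hw hRs1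
  have hURs : IsOpen {Y : PBond (F.P K) 0 → Matrix ι ι ℂ | ∀ b, w 1 b * ‖Y b‖ < Rs} := isOpen_weightedBall w Rs
  have h0Rs : (0 : PBond (F.P K) 0 → Matrix ι ι ℂ) ∈ {Y : PBond (F.P K) 0 → Matrix ι ι ℂ | ∀ b, w 1 b * ‖Y b‖ < Rs} := fun b => by simpa using hRs0
  have hCan : AnalyticAt ℂ (chartLog η D : (PBond (F.P K) 0 → Matrix ι ι ℂ) → BondIdx D → Matrix ι ι ℂ) 0 := han 0 h0Rs
  have hCω : ContDiffOn ℂ ω (chartLog η D : (PBond (F.P K) 0 → Matrix ι ι ℂ) → BondIdx D → Matrix ι ι ℂ)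
      {Y : PBond (F.P K) 0 → Matrix ι ι ℂ | ∀ b, w 1 b * ‖Y b‖ < Rs} := han.contDiffOn_of_completeSpace
  -- `H` as a continuous linear map (finite dimension); `Qlin ∘ H = 1`; (48) near `0`
  let Hc : (BondIdx D → Matrix ι ι ℂ) →L[ℂ] (PBond (F.P K) 0 → Matrix ι ι ℂ) := LinearMap.toContinuousLinearMap H
  have hHc : ∀ y, Hc y = H y := fun _ => rfl
  have hQH : ∀ y, Qlin (Hc y) = y := fun y => by rw [hHc]; exact hHinv y
  have h48 : ∀ᶠ B in 𝓝 (0 : PBond (F.P K) 0 → Matrix ι ι ℂ),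
      (chartLog η D : (PBond (F.P K) 0 → Matrix ι ι ℂ) → BondIdx D → Matrix ι ι ℂ) (B - Hc (Dfun B)) = Qlin B := by
    filter_upwards [hUn] with B hB
    rw [hHc]
    exact (hpt B hB).2.2.1
  -- the C-side identification and the order-two slice derivative
  have hC3 : ∀ A' : PBond (F.P K) 0 → Matrix ι ι ℂ,
      iteratedDeriv 3 (fun τ : ℂ => (chartLog η D : (PBond (F.P K) 0 → Matrix ι ι ℂ) → BondIdx D → Matrix ι ι ℂ) (τ • A')) 0 = ((Q₃ A') A') A' := by
    intro A'
    rw [iteratedDeriv_slice_eq_iteratedFDeriv hURs h0Rs hCω A' 3, iteratedFDeriv_three_apply_const]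
  have hD2 : ∀ A' : PBond (F.P K) 0 → Matrix ι ι ℂ, iteratedDeriv 2 (fun τ : ℂ => Dfun (τ • A')) 0 = (Q₂ A') A' := by
    intro A'
    rw [hdiag A' 2, iteratedFDeriv_two_apply, h56]
  -- §1 at the record
  have hmain3 : ∀ A' : PBond (F.P K) 0 → Matrix ι ι ℂ,
      iteratedDeriv 3 (fun τ : ℂ => Dfun (τ • A')) 0 = ((Q₃ A') A') A' - (3 : ℕ) • (Q₂ A') (H ((Q₂ A') A')) := by
    intro A'
    have h := iteratedDeriv_three_slice_eq_of_implicit hQH h48 hΦ0 h0 hΦa hCan rfl A'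
    rw [hD2 A', hHc] at h
    exact h
  refine ⟨H, Dfun, hHinv, hsup, hω, hfd, h0, hpt, hlinN, hlinK, h2N, h2K, hD2', hD3, h56, hsymD, hsymC, h56₂, hderD, hderC, hderD3,
    hC2N, hC3N, hQlinN, hQlinK, hQ2N, hQ2K, hsum, hdiag, hord0, hord1, hord2, hhom, hcau, htail, hC3, hmain3, ?_⟩
  -- print's shape: divide by `3!`, `2·½·½ = ½`
  intro A'
  rw [hmain3 A', hC3 A', map_smul, map_smul]
  set Z : BondIdx D → Matrix ι ι ℂ := (Q₂ A') (H ((Q₂ A') A')) with hZ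
  set W : BondIdx D → Matrix ι ι ℂ := ((Q₃ A') A') A' with hW
  have h3 : (3 : ℕ) • Z = (3 : ℂ) • Z := (Nat.cast_smul_eq_nsmul ℂ 3 Z).symm
  have h2' : (2 : ℕ) • ((2 : ℂ)⁻¹ • (2 : ℂ)⁻¹ • Z) = (2 : ℂ) • ((2 : ℂ)⁻¹ • (2 : ℂ)⁻¹ • Z) := (Nat.cast_smul_eq_nsmul ℂ 2 _).symm
  rw [h3, h2', Nat.factorial]
  norm_num
  module

end Summit.QuantumFields.YangMills.BalabanUVNodes.N07ChartD56Order3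

end
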